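import Literature.Geometry.Lorentzian.ExteriorRegionSchwarzschildEnd
import HarnessLib

/-!
# The mass parameter in the case of equality of Bray's Theorem 9 is the ADM energy
# (in support of the named fact `Bray2001_capacity_rigidity`)

Bray, J. Differential Geom. 59 (2001), Thm. 9 (§6), case of equality: *"`m = ½ ℰ(Σ, g)` if and
only if `(M³, g)` is isometric to a Schwarzschild metric of mass `m` outside their respective
horizons"*; the printed proof (§6, last paragraph of the proof of Thm. 9) ends with *"since
it has zero scalar curvature, it follows from equation [`R(u⁴ g₁) = u⁻⁵(−8Δ_{g₁} + R_{g₁})u`,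
Appendix A] that it must be a Schwarzschild metric. Hence, in the case of equality, `(M³, g)`
must be a Schwarzschild manifold outside `Σ`"* — the identification of the mass parameter of
that Schwarzschild metric with the total mass `m` of the chosen end being left implicit (the
total mass is an invariant of the end; Bartnik, CPAM 39 (1986), §3–§4). The named fact
`Bray2001_capacity_rigidity` (`MassCapacity.lean`) concludes, accordingly, with an isometry onto
the Schwarzschild exterior `{m/2 < ‖y‖}` of mass **`m = e.admEnergy D`**.

This file proves that last identification *inside the case of equality*, without any appeal to
the invariance of the ADM mass: if, under the equality `½ ℰ(Σ, g) = m` (`m = e.admEnergy D`, the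
hypothesis of the fact), the outside region `U` is isometric to the Schwarzschild exterior
`({m'/2 < ‖y‖}, (1 + m'/2‖y‖)⁴ δ)` of *some* mass `m' > 0`, then `m' = m` — because the capacity
of the horizon of such an exterior region, read in the end `e`, is `2m'`
(`horizonCapacity_toReal_div_two_eq_of_diffeomorph_schwarzschild`,
`ExteriorRegionSchwarzschildEnd.lean`: the isometry is an end structure of the same end as `e`),
so that `m' = ½ ℰ(Σ, g) = m`. Consequently, to establish the conclusion of
`Bray2001_capacity_rigidity` it suffices to produce an isometry of `U` onto a Schwarzschild
exterior of an arbitrary positive mass parameter — the form in which Steps 1–4 of the printed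
proof (doubling, Thm. 8, the singular positive mass rigidity of Bray–Finster, Bôcher) deliver it
(`ḡ = (a + b/‖y‖)⁴ δ` on `ℝ³ ∖ {0}`, of mass `2ab`):

* `admEnergy_eq_of_diffeomorph_schwarzschild_of_capacity_eq` — **`m' = m`**;
* `schwarzschild_conclusion_of_exists_mass` — the conclusion of `Bray2001_capacity_rigidity`
  from an isometry onto a Schwarzschild exterior of some mass `m' > 0`, for an exterior region of
  an end asymptotically flat of some order `α > 0` in the metric;
* `IsOutsideOf.schwarzschild_conclusion_of_exists_mass` — the same under the literal hypotheses
  of the fact (`IsOutsideOf e U f' ν'`, `e.IsAsymptoticallyFlat D 1`).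

Everything is proved; no definitions and no named facts are introduced.

## References

* H. L. Bray, *Proof of the Riemannian Penrose inequality using the positive mass theorem*,
  J. Differential Geom. 59 (2001) 177–267 (arXiv:math/9911173): §1 (12); §6 Def. 17, Thm. 9 and
  the last paragraph of its proof. (key `BrayRPI2001`)
* R. Bartnik, *The mass of an asymptotically flat manifold*, Comm. Pure Appl. Math. 39 (1986)
  661–693, §3–§4 (uniqueness of the mass of an end). (key `Bartnik1986`)
-/

noncomputable section

open Set Filter Function MeasureTheory Metric TopologicalSpace Manifold Bundle Bornology
open scoped ENNReal Topology Real Manifold ContDiff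

namespace Literature.Geometry.Lorentzian

open PseudoRiemannianMetric

variable {X : Type} [TopologicalSpace X] [ChartedSpace E3 X] [IsManifold (𝓡 3) ∞ X] [T2Space X]
  [SecondCountableTopology X] [LocallyCompactSpace X] [MeasurableSpace X] [BorelSpace X]
  {D : InitialDataSet (𝓡 3) X} [D.metric.HasLeviCivita] {e : AFEnd X} {U : Opens X}

/-- **The mass parameter in the case of equality of Thm. 9 is the total mass.** Let `U` be an
exterior region of the end `e` of `(X, h)`, `e` asymptotically flat of some order `α > 0` in the
metric, and assume the equality `½ ℰ(∂U, h) = m` of Bray's Theorem 9, `m = e.admEnergy D`. If `U`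
is isometric to the Schwarzschild exterior of mass `m' > 0` — a diffeomorphism
`Φ : U ≅ {m'/2 < ‖y‖}` with `Φ^* ((1 + m'/2‖y‖)⁴ δ) = h` on `U` — then `m = m'`: the capacity of
the horizon of such a region is `2m'`
(`horizonCapacity_toReal_div_two_eq_of_diffeomorph_schwarzschild`, the "if" direction of the
case of equality), and `½ ℰ = m` by hypothesis. Bray 2001, Thm. 9,
case of equality ("a Schwarzschild metric of mass `m`").
[cite: BrayRPI2001, §6 Thm. 9 (case of equality) with Def. 17 and §1 (12)] -/
theorem admEnergy_eq_of_diffeomorph_schwarzschild_of_capacity_eq {α : ℝ} (hα : 0 < α)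
    (hAF : e.IsMetricAsymptoticallyFlat D α) (hU : IsExteriorRegion e U)
    (heq : (horizonCapacity D.h e U).toReal / 2 = e.admEnergy D) {m' : ℝ} (hm' : 0 < m')
    (Φ : Diffeomorph (𝓡 3) (𝓡 3) U (exteriorRegion (m' / 2)) ∞)
    (hΦ : ∀ x : U, pullbackBilin (I := 𝓡 3) (I' := 𝓡 3) Φ
      (fun y ↦ (1 + m' / (2 * ‖(y : E3)‖)) ^ 4 •
        (innerSL ℝ (E := E3) : E3 →L[ℝ] E3 →L[ℝ] ℝ)) x = D.metric.val x.1) :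
    e.admEnergy D = m' := by
  have ha : 0 < m' / 2 := by positivity
  -- the Schwarzschild factor `1 + m'/(2‖y‖) = 1 + (m'/2)/‖y‖`
  have hΦ' : ∀ x : U, pullbackBilin (I := 𝓡 3) (I' := 𝓡 3) Φ
      (fun y ↦ (1 + m' / 2 / ‖(y : E3)‖) ^ 4 •
        (innerSL ℝ (E := E3) : E3 →L[ℝ] E3 →L[ℝ] ℝ)) x = D.metric.val x.1 := by
    intro x
    simp only [div_div]
    exact hΦ x
  rw [← heq, horizonCapacity_toReal_div_two_eq_of_diffeomorph_schwarzschild Φ ha hα hAF hU hΦ']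
  ring

/-- **Rigidity up to the mass parameter suffices.** Under the equality `½ ℰ(∂U, h) = m`
(`m = e.admEnergy D`) for an exterior region `U` of an end asymptotically flat of some order
`α > 0` in the metric, an isometry of `U` onto the Schwarzschild exterior of *some* mass
`m' > 0` yields the conclusion of `Bray2001_capacity_rigidity`: an isometry onto the
Schwarzschild exterior `{m/2 < ‖y‖}` of mass `m = e.admEnergy D`, `Φ^* ((1 + m/2‖y‖)⁴ δ) = h`
(indeed `m' = m`, `admEnergy_eq_of_diffeomorph_schwarzschild_of_capacity_eq`). This is the form
in which the printed proof delivers the case of equality ("`ḡ` is Schwarzschild", of mass `2ab`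
for `ḡ = (a + b/‖y‖)⁴ δ` on `ℝ³ ∖ {0}`). Bray 2001, Thm. 9, case of equality, last paragraph of
the proof. [cite: BrayRPI2001, §6 Thm. 9 (case of equality), end of the proof] -/
theorem schwarzschild_conclusion_of_exists_mass {α : ℝ} (hα : 0 < α)
    (hAF : e.IsMetricAsymptoticallyFlat D α) (hU : IsExteriorRegion e U)
    (heq : (horizonCapacity D.h e U).toReal / 2 = e.admEnergy D)
    (h : ∃ m' : ℝ, 0 < m' ∧ ∃ Φ : Diffeomorph (𝓡 3) (𝓡 3) U (exteriorRegion (m' / 2)) ∞,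
      ∀ x : U, pullbackBilin (I := 𝓡 3) (I' := 𝓡 3) Φ
        (fun y ↦ (1 + m' / (2 * ‖(y : E3)‖)) ^ 4 •
          (innerSL ℝ (E := E3) : E3 →L[ℝ] E3 →L[ℝ] ℝ)) x = D.metric.val x.1) :
    ∃ Φ : Diffeomorph (𝓡 3) (𝓡 3) U (exteriorRegion (e.admEnergy D / 2)) ∞,
      ∀ x : U, pullbackBilin (I := 𝓡 3) (I' := 𝓡 3) Φ
        (fun y ↦ (1 + e.admEnergy D / (2 * ‖(y : E3)‖)) ^ 4 •
          (innerSL ℝ (E := E3) : E3 →L[ℝ] E3 →L[ℝ] ℝ)) x = D.metric.val x.1 := by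
  obtain ⟨m', hm', Φ, hΦ⟩ := h
  obtain rfl : e.admEnergy D = m' :=
    admEnergy_eq_of_diffeomorph_schwarzschild_of_capacity_eq hα hAF hU heq hm' Φ hΦ
  exact ⟨Φ, hΦ⟩

/-- **The same under the literal hypotheses of `Bray2001_capacity_rigidity`**: for the outside
region `U` of a surface `Σ ∈ 𝒮` towards the end `e` (`IsOutsideOf e U f' ν'`; only its last
clause, `IsExteriorRegion e U`, is used), `e` asymptotically flat of order `1` (Bray's Def. 21 with
`p = 1`; only the metric part is used), and the equality `½ ℰ(Σ, g) = m`, an isometry of `U` onto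
a Schwarzschild exterior of some mass `m' > 0` yields the conclusion of the fact (mass parameter
`m = e.admEnergy D`). Bray 2001, Thm. 9, case of equality.
[cite: BrayRPI2001, §6 Thm. 9 (case of equality), end of the proof] -/
theorem IsOutsideOf.schwarzschild_conclusion_of_exists_mass {S' : Type*} {f' : S' → X}
    {ν' : NormalField (𝓡 3) f'} (hU : IsOutsideOf e U f' ν')
    (hAF : e.IsAsymptoticallyFlat D 1)
    (heq : (horizonCapacity D.h e U).toReal / 2 = e.admEnergy D)
    (h : ∃ m' : ℝ, 0 < m' ∧ ∃ Φ : Diffeomorph (𝓡 3) (𝓡 3) U (exteriorRegion (m' / 2)) ∞,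
      ∀ x : U, pullbackBilin (I := 𝓡 3) (I' := 𝓡 3) Φ
        (fun y ↦ (1 + m' / (2 * ‖(y : E3)‖)) ^ 4 •
          (innerSL ℝ (E := E3) : E3 →L[ℝ] E3 →L[ℝ] ℝ)) x = D.metric.val x.1) :
    ∃ Φ : Diffeomorph (𝓡 3) (𝓡 3) U (exteriorRegion (e.admEnergy D / 2)) ∞,
      ∀ x : U, pullbackBilin (I := 𝓡 3) (I' := 𝓡 3) Φ
        (fun y ↦ (1 + e.admEnergy D / (2 * ‖(y : E3)‖)) ^ 4 •
          (innerSL ℝ (E := E3) : E3 →L[ℝ] E3 →L[ℝ] ℝ)) x = D.metric.val x.1 :=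
  Literature.Geometry.Lorentzian.schwarzschild_conclusion_of_exists_mass one_pos
    hAF.isMetricAsymptoticallyFlat hU.isExteriorRegion heq h

end Literature.Geometry.Lorentzian

end
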